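import Mathlib
import Literature.NumberTheory.Transcendental.NesterenkoGenericPoints
import Summits.MatrixMultiplication.MatrixMultiplication.Theorems.FidelityWitnessesFidelityGapThreeSeventeenPunctualDefs

/-!
# Borel-fixed border apolarity at `(⟨3,3,3⟩, 17)` — part 2: countable avoidance over `ℂ` and a
# configuration of points in general position in EVERY multidegree

Crux `stmt-MatrixMultiplication-4958` (`FidelityWitnesses.FidelityGapThreeSeventeen`), line
`punctual-saturation`, stub `stub_borelFixedApolarity` (helper file; general, reusable).

* `Avoid.dense_forall_eval_ne_zero` — countably many non-zero polynomials in finitely many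
  variables over `ℂ` have a common non-zero, indeed off a meagre set (Baire in `ℂ^σ`; a polynomial
  vanishing on a non-empty open set is zero, `Nesterenko.eq_zero_of_eval_eq_zero_of_isOpen`);
  `Avoid.dense_forall_polynomial_eval_ne_zero` — the one-variable case (countably many roots).
* `GenPos.finrank_inf_ker_add_one` — a functional not vanishing on a finite-dimensional subspace
  cuts it in codimension exactly one.
* `GenPos.exists_config` — for a positive multigrading `w : σ → ℕ^ι` of `ℂ[x_σ]` and every `k`
  there are `k` points imposing `min (k, dim S_m)` independent conditions on EVERY piece `S_m`
  (add the points one at a time, each off the countably many hypersurfaces `{f_m = 0}`,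
  `0 ≠ f_m ∈ I(previous points)_m`);
* the registered sub-goal `stub_borelFixedApolarity_genpos : ∃ c : Config, InGeneralPosition c`
  (`17` points of `C ⊕ A ⊕ B` in general position in all multidegrees: the constant configuration
  towards which an approximate decomposition is perturbed, CHL 2023 §2.3 "we may choose the curves
  such that `codim I_{ijk} = r`", here for all `(ijk)` at once).

References: A. Conner, A. Harper, J. M. Landsberg, Forum Math. Pi 11 (2023) e17, §2.3;
W. Buczyńska, J. Buczyński, Duke Math. J. 170 (2021), Thm 1.2. Elementary; everything proved.
-/

noncomputable section

namespace Summit.MatrixMultiplication.MatrixMultiplication.Theorems.PunctualSaturation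

-- single-conjunct summit: the `Summit.<S>.<P>` prefix repeats `MatrixMultiplication` by design (D-0017)
set_option linter.dupNamespace false

open MvPolynomial Module

/-! ## Countable avoidance over `ℂ` -/

namespace Avoid

/-- **Countably many non-zero polynomials over `ℂ` in finitely many variables are simultaneously
non-zero on a dense set** (Baire). [folklore] -/
theorem dense_forall_eval_ne_zero {σ : Type*} [Fintype σ] {ι : Type*} [Countable ι]
    (f : ι → MvPolynomial σ ℂ) (hf : ∀ i, f i ≠ 0) :
    Dense {x : σ → ℂ | ∀ i, eval x (f i) ≠ 0} := by
  have hset : {x : σ → ℂ | ∀ i, eval x (f i) ≠ 0} = ⋂ i, {x | eval x (f i) ≠ 0} := by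
    ext x; simp
  rw [hset]
  refine dense_iInter_of_isOpen (fun i => ?_) (fun i => ?_)
  · exact (isClosed_eq (MvPolynomial.continuous_eval (f i)) continuous_const).isOpen_compl
  · have hc : {x : σ → ℂ | eval x (f i) ≠ 0} = {x | eval x (f i) = 0}ᶜ := by ext x; simp
    rw [hc, ← interior_eq_empty_iff_dense_compl]
    by_contra hne
    refine hf i (Literature.NumberTheory.Transcendental.Nesterenko.eq_zero_of_eval_eq_zero_of_isOpen
      (f i) isOpen_interior (Set.nonempty_iff_ne_empty.2 hne) fun z hz => ?_)
    exact (interior_subset hz : z ∈ {x : σ → ℂ | eval x (f i) = 0})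

/-- **Countably many non-zero one-variable polynomials over `ℂ` are simultaneously non-zero on a
dense set** (their roots form a countable set). [folklore] -/
theorem dense_forall_polynomial_eval_ne_zero {ι : Type*} [Countable ι] (f : ι → Polynomial ℂ)
    (hf : ∀ i, f i ≠ 0) : Dense {z : ℂ | ∀ i, (f i).eval z ≠ 0} := by
  have hset : {z : ℂ | ∀ i, (f i).eval z ≠ 0} = (⋃ i, {z | (f i).IsRoot z})ᶜ := by
    ext z; simp [Polynomial.IsRoot]
  rw [hset]
  exact Set.Countable.dense_compl ℂ
    (Set.countable_iUnion fun i => (Polynomial.finite_setOf_isRoot (hf i)).countable)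

/-- Small common non-roots: for every `δ > 0` some `z` with `‖z‖ < δ` is a root of none of countably
many non-zero polynomials. [folklore] -/
theorem exists_norm_lt_forall_eval_ne_zero {ι : Type*} [Countable ι] (f : ι → Polynomial ℂ)
    (hf : ∀ i, f i ≠ 0) {δ : ℝ} (hδ : 0 < δ) : ∃ z : ℂ, ‖z‖ < δ ∧ ∀ i, (f i).eval z ≠ 0 := by
  obtain ⟨z, hz, hzU⟩ := (dense_forall_polynomial_eval_ne_zero f hf).exists_mem_open
    Metric.isOpen_ball ⟨0, Metric.mem_ball_self hδ⟩
  exact ⟨z, by simpa using hzU, hz⟩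

end Avoid

/-! ## Points in general position in every multidegree -/

namespace GenPos

variable {K : Type*} [Field K]

/-- A functional not vanishing on a finite-dimensional subspace `W` cuts it in codimension one:
`dim (W ∩ ker φ) + 1 = dim W`. [folklore] -/
theorem finrank_inf_ker_add_one {V : Type*} [AddCommGroup V] [Module K V] (W : Submodule K V)
    [FiniteDimensional K W] (φ : V →ₗ[K] K) {f : V} (hfW : f ∈ W) (hf : φ f ≠ 0) :
    finrank K ↥(W ⊓ LinearMap.ker φ) + 1 = finrank K W := by
  set ψ : W →ₗ[K] K := φ ∘ₗ W.subtype with hψ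
  have hsurj : Function.Surjective ψ := fun a =>
    ⟨(a * (φ f)⁻¹) • ⟨f, hfW⟩, by simp [hψ, hf]⟩
  have h := LinearMap.finrank_range_add_finrank_ker ψ
  rw [LinearMap.range_eq_top.2 hsurj, finrank_top, Module.finrank_self] at h
  have hker : LinearMap.ker ψ = Submodule.comap W.subtype (LinearMap.ker φ) := by
    rw [hψ, LinearMap.ker_comp]
  have hk : finrank K (LinearMap.ker ψ) = finrank K ↥(W ⊓ LinearMap.ker φ) := by
    rw [hker]
    exact ((Submodule.equivMapOfInjective _ W.injective_subtype _).trans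
      (LinearEquiv.ofEq _ _ (Submodule.map_comap_subtype _ _))).finrank_eq
  omega

/-- Splitting an infimum over `Fin (k + 1)` at the first index. [folklore] -/
theorem iInf_fin_succ {α : Type*} [CompleteLattice α] {k : ℕ} (F : Fin (k + 1) → α) :
    (⨅ ρ, F ρ) = F 0 ⊓ ⨅ ρ : Fin k, F ρ.succ := by
  refine le_antisymm (le_inf (iInf_le _ 0) (le_iInf fun ρ => iInf_le _ _)) (le_iInf fun ρ => ?_)
  refine Fin.cases inf_le_left (fun i => inf_le_right.trans (iInf_le _ i)) ρ

variable {σ : Type} [Fintype σ] {ι : Type} [Fintype ι] (w : σ → ι → ℕ)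

/-- **`k` points in general position in every multidegree exist** over `ℂ` (positive multigrading):
`dim {f ∈ S_m : f(c_ρ) = 0 ∀ ρ} + min (k, dim S_m) = dim S_m` for all `m` simultaneously.
[cite: ConnerHarperLandsberg2023, §2.3] -/
theorem exists_config (hw : ∀ v, w v ≠ 0) (k : ℕ) :
    ∃ c : Fin k → σ → ℂ, ∀ m : ι → ℕ,
      finrank ℂ ↥(weightedHomogeneousSubmodule ℂ w m ⊓
          ⨅ ρ, LinearMap.ker (aeval (c ρ)).toLinearMap) +
        min k (finrank ℂ ↥(weightedHomogeneousSubmodule ℂ w m)) =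
      finrank ℂ ↥(weightedHomogeneousSubmodule ℂ w m) := by
  haveI hfin : ∀ m : ι → ℕ, Module.Finite ℂ (weightedHomogeneousSubmodule ℂ w m) :=
    fun m => Literature.RingTheory.MvPolynomial.finite_weightedHomogeneousSubmodule_of_ne_zero w hw m
  induction k with
  | zero =>
    refine ⟨fun ρ => Fin.elim0 ρ, fun m => ?_⟩
    have htop : (⨅ ρ : Fin 0, LinearMap.ker
        (aeval (Fin.elim0 ρ : σ → ℂ) : MvPolynomial σ ℂ →ₐ[ℂ] ℂ).toLinearMap) = ⊤ :=
      iInf_eq_top.2 fun ρ => Fin.elim0 ρ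
    rw [htop, inf_top_eq, Nat.zero_min, add_zero]
  | succ k ih =>
    obtain ⟨c, hc⟩ := ih
    -- the pieces cut out by the first `k` points
    set W : (ι → ℕ) → Submodule ℂ (MvPolynomial σ ℂ) := fun m =>
      weightedHomogeneousSubmodule ℂ w m ⊓ ⨅ ρ, LinearMap.ker (aeval (c ρ)).toLinearMap with hW
    haveI : ∀ m, Module.Finite ℂ (W m) := fun m =>
      Module.Finite.of_injective (Submodule.inclusion (inf_le_left : W m ≤ _))
        (Submodule.inclusion_injective _)
    -- one non-zero form in each non-zero piece, and a point off all of them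
    have hex : ∀ t : {m : ι → ℕ // W m ≠ ⊥}, ∃ f, f ∈ W t.1 ∧ f ≠ 0 := fun t =>
      Submodule.exists_mem_ne_zero_of_ne_bot t.2
    choose f hfW hf0 using hex
    obtain ⟨x, hx⟩ := (Avoid.dense_forall_eval_ne_zero f hf0).nonempty
    refine ⟨(Fin.cons x c : Fin (k + 1) → σ → ℂ), fun m => ?_⟩
    have hsplit : weightedHomogeneousSubmodule ℂ w m ⊓
        (⨅ ρ, LinearMap.ker (aeval ((Fin.cons x c : Fin (k + 1) → σ → ℂ) ρ)).toLinearMap) =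
        W m ⊓ LinearMap.ker (aeval x).toLinearMap := by
      rw [iInf_fin_succ]
      simp only [Fin.cons_zero, Fin.cons_succ, hW]
      ac_rfl
    rw [hsplit]
    have hcm := hc m
    by_cases hbot : W m = ⊥
    · have h0 : W m ⊓ LinearMap.ker (aeval x).toLinearMap = ⊥ := by rw [hbot, bot_inf_eq]
      rw [h0, finrank_bot]
      change finrank ℂ ↥(W m) + _ = _ at hcm
      rw [hbot, finrank_bot] at hcm
      omega
    · have h1 := finrank_inf_ker_add_one (W m) (aeval x).toLinearMap (hfW ⟨m, hbot⟩) (by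
        simpa [MvPolynomial.coe_aeval_eq_eval] using hx ⟨m, hbot⟩)
      change finrank ℂ ↥(W m) + _ = _ at hcm
      have hpos : 0 < finrank ℂ ↥(W m) := by
        rw [pos_iff_ne_zero, Ne, Submodule.finrank_eq_zero]; exact hbot
      omega

end GenPos

/-- `wt v ≠ 0`: the grading of the Cox ring is positive. [folklore] -/
theorem wt_ne_zero (v : Var) : wt v ≠ 0 := fun h => by
  have := congr_fun h v.1
  simp [wt] at this

/-- The vanishing piece at a configuration as an intersection of kernels. [folklore] -/
theorem vanishPiece_eq (γ : Config) (D : Fin 3 → ℕ) :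
    vanishPiece γ D = SD D ⊓ ⨅ ρ, LinearMap.ker (aeval (γ ρ)).toLinearMap := by
  rw [vanishPiece, evalAt, LinearMap.ker_pi, inf_comm]

/-- **Registered sub-goal `stub_borelFixedApolarity_genpos` of `stub_borelFixedApolarity`**: there is a
configuration of `17` points of `C ⊕ A ⊕ B` in general position in EVERY multidegree.
[cite: ConnerHarperLandsberg2023, §2.3] -/
theorem stub_borelFixedApolarity_genpos : ∃ c : Config, InGeneralPosition c := by
  obtain ⟨c, hc⟩ := GenPos.exists_config wt wt_ne_zero 17
  refine ⟨c, fun D => ?_⟩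
  rw [vanishPiece_eq]
  exact hc D

end Summit.MatrixMultiplication.MatrixMultiplication.Theorems.PunctualSaturation

end
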